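import Summits.PneNP.Statement
import Literature.Computability.Complexity.ClayProblem
import Literature.Computability.Complexity.Nondeterministic
import Literature.Computability.Learning.PAC

/-!
# PneNP / Learning — assembly

Route `PneNP/Learning`, item `stmt-PneNP-0415` (assembly, honest form). Thesis `X` of the route
(`stmt-PneNP-0414`): for some `k`, the concept class `SIZE[n^k]`
(`Literature.Learning.sizeClass B2 (n ↦ n^k)`) is not PAC learnable in polynomial time — distribution
free, random examples only, polynomially evaluatable hypotheses
(`Literature.Learning.PolyPACPredictable allDistributions false`). The assembly `X → PneNP` consumes,
as explicit hypotheses,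

* the model bridges `Literature.Computability.Complexity.P_bool_eq`, `Literature.Computability.Complexity.NP_bool_eq` and `Literature.Computability.Complexity.P_subset_NP`
  (named facts of the tree), and
* the Occam step "if `P = NP` then every `SIZE[n^k]` is polynomially PAC learnable"
  (Blumer–Ehrenfeucht–Haussler–Warmuth, J. ACM 36 (1989), Thm. 2.1, with the observation that
  under `P = NP` a circuit of size `n^k` consistent with the sample is found in polynomial time;
  Pitt–Valiant 1988, §1) — KNOWN in print, not yet a named fact of the tree, hence inlined.

Given these the proof is propositional: `X` and Occam give `CplxCore.P ≠ CplxCore.NP`; with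
`P ⊆ NP` some `L ∈ NP \ P`; the bridges rewrite this as Cook's `PneNP`.
-/

namespace Literature.Learning

/-- Settles `stmt-PneNP-0415` (assembly of route Learning, honest form): the model bridges
`P_bool_eq`, `NP_bool_eq`, the inclusion `P ⊆ NP`, the Occam-under-`P = NP` learnability of every
`SIZE[n^k]` (BEHW 1989, Thm. 2.1; Pitt–Valiant 1988, §1) and the route thesis (some `SIZE[n^k]`
is not polynomially PAC learnable) together give `P ≠ NP` in Cook's form. Propositional glue.
[folklore] -/
theorem learning_assembly :
    Literature.Computability.Complexity.P_bool_eq → Literature.Computability.Complexity.NP_bool_eq → Literature.Computability.Complexity.P_subset_NP →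
    (Literature.Computability.Complexity.Classes.P = Literature.Computability.Complexity.Nondeterministic.NP → ∀ k : ℕ, Literature.Computability.Learning.PolyPACPredictable
      Literature.Computability.Learning.allDistributions false (Literature.Computability.Learning.sizeClass Literature.Computability.Complexity.B2 (fun n => n ^ k))) →
    (∃ k : ℕ, ¬ Literature.Computability.Learning.PolyPACPredictable Literature.Computability.Learning.allDistributions false
      (Literature.Computability.Learning.sizeClass Literature.Computability.Complexity.B2 (fun n => n ^ k))) → PneNP := by
  intro hP hNP hsub hOccam hX
  obtain ⟨k, hk⟩ := hX
  have hne : Literature.Computability.Complexity.Classes.P ≠ Literature.Computability.Complexity.Nondeterministic.NP := fun h => hk (hOccam h k)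
  by_contra hcon
  apply hne
  refine Set.Subset.antisymm hsub fun L hL => ?_
  by_contra hLP
  exact hcon ⟨L, by rw [show Literature.Computability.Complexity.PNPWave0.NP Bool = _ from hNP]; exact hL,
    by rw [show Literature.Computability.Complexity.PNPWave0.P Bool = _ from hP]; exact hLP⟩

/-- The same glue with the thesis strengthened to its uniform core: if `P ≠ NP` in the prelude's
classes (however obtained), the bridges and `P ⊆ NP` give Cook's `PneNP`. [folklore] -/
theorem pneNP_of_P_ne_NP :
    Literature.Computability.Complexity.P_bool_eq → Literature.Computability.Complexity.NP_bool_eq → Literature.Computability.Complexity.P_subset_NP →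
    Literature.Computability.Complexity.Classes.P ≠ Literature.Computability.Complexity.Nondeterministic.NP → PneNP := by
  intro hP hNP hsub hne
  by_contra hcon
  apply hne
  refine Set.Subset.antisymm hsub fun L hL => ?_
  by_contra hLP
  exact hcon ⟨L, by rw [show Literature.Computability.Complexity.PNPWave0.NP Bool = _ from hNP]; exact hL,
    by rw [show Literature.Computability.Complexity.PNPWave0.P Bool = _ from hP]; exact hLP⟩

end Literature.Learning
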